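import Summits.CriticalPhenomena.PercolationContinuityZ3.Theorems.PercNearOneGluingAdditiveGluingFibreSeedStep
import HarnessLib

/-!
# Crux `PercNearOneGluing.AdditiveGluing` (stmt-CriticalPhenomena-4576), line `tieline`:
# the tagged contraction recursion for (T)'s fibre counts closes — (CNT) reduces to its core-inert base case (KEY₃)

Support file (`--supports stmt-CriticalPhenomena-4576`, helper, seat (d) exchange-certificate form, gen 8).  No named facts, no sorries;
definitions = the explicit tagged summand (`rchS`, `tail3`, `wNon`, `wSeed`, `tagSum`, `headFac`, `tagSummandL`).

`…FibreSeedStep` proved the one-step identity `fibreSumT I = fibreSumT (I[e ↦ 3]) + fibreSumF (tagSummand y) (I[e ↦ 0])`.  Iterating it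
produces vertices carrying several "tag events" (one per decomposed core edge at them, solo or duo); memo EXCHCERT-g8 §2 and lab/gmul.py show
that the tag events behave INDEPENDENTLY: each event at `y` contributes either its non-seed weight (`(1−m)+(1−k₂)` solo, `(1−m)(1−k₂)` duo;
`m = [y ∈ M₁]`, `k₂ = [y ∈ K₂]`, clusters of `c` in replica 1 and of `u` in replica 2) or its seed weight (`1−(1−m)(1−k₂)` resp. `1 − m·k₂`),
and `y` is a replica-3 seed of `v` iff at least one of its events chose "seed".  This is the list fold `tagSum`; the tagged summand is
`tagSummandL tags = [c∉K₁][c∉L₁][u∉L₂] · tagSum tags {v}` with tail `[u ∉ L₃^A]·([b∈K₂]−[b∈K₃])·([o∈L₃^A] − [o↔₁c][c∈L₃^A])` at seed set `A`.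
MAIN IDENTITY (`fibreSumL_soloStep` / `fibreSumL_duoStep`): for EVERY edge `e = s(x, y)` with `x` in the `3`-component of `v` (no condition on `y`:
it may be tagged already, equal to `u`, `o`, `b`, `c`) and `I e = 1` (resp. `2`),
  `fibreSumF (tagSummandL tags) I = fibreSumF (tagSummandL tags) (I[e ↦ 3]) + fibreSumF (tagSummandL ((y, solo?) :: tags)) (I[e ↦ 0])`.
Since both count vectors on the right have fewer random edges, induction gives (`fibreSumL_nonneg_of_base`, `fibreSumT_nonneg_of_base`):
**if every tagged count whose count vector has NO random edge at the `3`-component of `v` is nonnegative ("(KEY₃)", v's core inert —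
0 violations in ttrl2's census of 2.6·10⁸ rows incl. the graph that refutes the two-replica analogue, fibre/SGKEY.md), then every fibre count
of (T) is nonnegative**, hence (T) at these roles for all weights (`covTransferQ_of_fibres`).  `tagSummandL [] = summandT` (`tagSummandL_nil`).
[folklore] (one-edge surgery on open paths; bookkeeping of a linear recursion by a list fold)
-/

namespace Summit.CriticalPhenomena.PercolationContinuityZ3.Cruxes.AdditiveGluing.TieLine.FibreCount

open MeasureTheory Set Finset Literature.Probability.Percolation
open Literature.Probability.LatticeModels (prodBernoulli)

open Classical

section TagFold

variable {n : ℕ}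

/-- Real indicator that `w` is reached in the open graph of `a` from some vertex of the seed set `A`. [folklore] -/
noncomputable def rchS (a : Sym2 (Fin n) → Bool) (A : Finset (Fin n)) (w : Fin n) : ℝ :=
  ir (∃ z ∈ A, (openGraph (cfg a)).Reachable z w)

/-- The replica-3 tail at seed set `A`: `[u ∉ L₃^A] · ([b∈K₂] − [b∈K₃]) · ([o ∈ L₃^A] − [o ↔₁ c]·[c ∈ L₃^A])`. [folklore] -/
noncomputable def tail3 (o b u c : Fin n) (t : Triple (Sym2 (Fin n))) (A : Finset (Fin n)) : ℝ :=
  (1 - rchS t.2.2 A u) * (rch t.2.1 u b - rch t.2.2 u b) * (rchS t.2.2 A o - rch t.1 o c * rchS t.2.2 A c)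

/-- Non-seed weight of one tag event at `y` (`solo = true`: `(1−m)+(1−k₂)`; duo: `(1−m)(1−k₂)`). [folklore] -/
noncomputable def wNon (u c y : Fin n) (t : Triple (Sym2 (Fin n))) (solo : Bool) : ℝ :=
  if solo then (1 - rch t.1 c y) + (1 - rch t.2.1 u y) else (1 - rch t.1 c y) * (1 - rch t.2.1 u y)

/-- Seed weight of one tag event at `y` (solo: `1 − (1−m)(1−k₂)`; duo: `1 − m·k₂`). [folklore] -/
noncomputable def wSeed (u c y : Fin n) (t : Triple (Sym2 (Fin n))) (solo : Bool) : ℝ :=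
  if solo then 1 - (1 - rch t.1 c y) * (1 - rch t.2.1 u y) else 1 - rch t.1 c y * rch t.2.1 u y

/-- **The tag fold.**  Each tag event independently takes its non-seed weight (seed set unchanged) or its seed weight (its vertex joins
the replica-3 seed set); at the end the replica-3 tail is evaluated at the accumulated seed set. [folklore] -/
noncomputable def tagSum (o b u c : Fin n) (t : Triple (Sym2 (Fin n))) : List (Fin n × Bool) → Finset (Fin n) → ℝ
  | [], A => tail3 o b u c t A
  | (y, solo) :: rest, A => wNon u c y t solo * tagSum o b u c t rest A + wSeed u c y t solo * tagSum o b u c t rest (insert y A)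

/-- The common head factor `[c ∉ K₁][c ∉ L₁][u ∉ L₂]`. [folklore] -/
noncomputable def headFac (u v c : Fin n) (t : Triple (Sym2 (Fin n))) : ℝ :=
  (1 - rch t.1 c u) * (1 - rch t.1 c v) * (1 - rch t.2.1 u v)

/-- **The tagged summand** of the kernel's fibre counts for a list of tag events. [folklore] -/
noncomputable def tagSummandL (o b u v c : Fin n) (tags : List (Fin n × Bool)) (t : Triple (Sym2 (Fin n))) : ℝ :=
  headFac u v c t * tagSum o b u c t tags {v}

/-- Reaching from a singleton seed set. [folklore] -/
theorem rchS_singleton (a : Sym2 (Fin n) → Bool) (v w : Fin n) : rchS a {v} w = rch a v w := by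
  unfold rchS rch
  exact ir_congr ⟨fun ⟨z, hz, h⟩ => by rwa [Finset.mem_singleton.1 hz] at h, fun h => ⟨v, Finset.mem_singleton_self v, h⟩⟩

/-- With no tags the tagged summand is the summand of (T). [folklore] -/
theorem tagSummandL_nil (o b u v c : Fin n) (t : Triple (Sym2 (Fin n))) : tagSummandL o b u v c [] t = summandT o b u v c t := by
  unfold tagSummandL tagSum tail3 headFac summandT
  rw [rchS_singleton, rchS_singleton, rchS_singleton]
  have h : rch t.2.2 v u = rch t.2.2 u v := by unfold rch; exact ir_congr SimpleGraph.reachable_comm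
  rw [h]; ring

/-- The fold depends on replica 1 only through `[c ↔₁ ·]` and `[o ↔₁ c]`. [folklore] -/
theorem tagSum_congr_rep1 (o b u c : Fin n) (a a' a₂ a₃ : Sym2 (Fin n) → Bool) (hc : ∀ z, rch a' c z = rch a c z)
    (hoc : rch a' o c = rch a o c) :
    ∀ (tags : List (Fin n × Bool)) (A : Finset (Fin n)), tagSum o b u c (a', a₂, a₃) tags A = tagSum o b u c (a, a₂, a₃) tags A := by
  intro tags
  induction tags with
  | nil => intro A; simp only [tagSum, tail3, hoc]
  | cons hd rest ih =>
    intro A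
    obtain ⟨y, solo⟩ := hd
    simp only [tagSum, wNon, wSeed, hc, ih]

/-- The fold depends on replica 2 only through `[u ↔₂ ·]`. [folklore] -/
theorem tagSum_congr_rep2 (o b u c : Fin n) (a₁ a a' a₃ : Sym2 (Fin n) → Bool) (hu : ∀ z, rch a' u z = rch a u z) :
    ∀ (tags : List (Fin n × Bool)) (A : Finset (Fin n)), tagSum o b u c (a₁, a', a₃) tags A = tagSum o b u c (a₁, a, a₃) tags A := by
  intro tags
  induction tags with
  | nil => intro A; simp only [tagSum, tail3, hu]
  | cons hd rest ih =>
    intro A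
    obtain ⟨y, solo⟩ := hd
    simp only [tagSum, wNon, wSeed, hu, ih]

/-- Reaching from a seed set after inserting the edge `s(x,y)`, when the seed set reaches `x`. [folklore] -/
theorem exists_reach_insert_iff {ω : Set (Sym2 (Fin n))} {A : Finset (Fin n)} {x y : Fin n} (hA : ∃ z ∈ A, (openGraph ω).Reachable z x)
    (w : Fin n) :
    (∃ z ∈ A, (openGraph (insert s(x, y) ω)).Reachable z w) ↔ ∃ z ∈ insert y A, (openGraph ω).Reachable z w := by
  obtain ⟨z₀, hz₀, hz₀x⟩ := hA
  constructor
  · rintro ⟨z, hz, h⟩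
    rcases reachable_insert_cases h with h1 | ⟨_, h3⟩ | ⟨_, h5⟩
    · exact ⟨z, Finset.mem_insert_of_mem hz, h1⟩
    · exact ⟨y, Finset.mem_insert_self y A, h3⟩
    · exact ⟨z₀, Finset.mem_insert_of_mem hz₀, hz₀x.trans h5⟩
  · rintro ⟨z, hz, h⟩
    rcases Finset.mem_insert.1 hz with rfl | hz'
    · exact ⟨z₀, hz₀, (reachable_insert_of_reachable hz₀x).trans
        ((reachable_insert_endpoints ω x z).trans (reachable_insert_of_reachable h))⟩
    · exact ⟨z, hz', reachable_insert_of_reachable h⟩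

/-- The replica-3 tail after opening `e` at a seed set reaching `x` is the tail at the seed set enlarged by `y`. [folklore] -/
theorem tail3_open3 (o b u c : Fin n) (a₁ a₂ a : Sym2 (Fin n) → Bool) (x y : Fin n) (A : Finset (Fin n))
    (hA : ∃ z ∈ A, (openGraph (cfg a)).Reachable z x) :
    tail3 o b u c (a₁, a₂, Function.update a s(x, y) true) A = tail3 o b u c (a₁, a₂, a) (insert y A) := by
  unfold tail3 rchS
  simp only
  rw [cfg_update_true]
  rw [ir_congr (exists_reach_insert_iff hA u), ir_congr (exists_reach_insert_iff hA o), ir_congr (exists_reach_insert_iff hA c)]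
  by_cases hu : ∃ z ∈ insert y A, (openGraph (cfg a)).Reachable z u
  · rw [ir_of_true hu]; ring
  · have huy : ¬ (openGraph (cfg a)).Reachable u y := fun h => hu ⟨y, Finset.mem_insert_self y A, h.symm⟩
    have hux : ¬ (openGraph (cfg a)).Reachable u x := by
      obtain ⟨z₀, hz₀, hz₀x⟩ := hA
      exact fun h => hu ⟨z₀, Finset.mem_insert_of_mem hz₀, hz₀x.trans h.symm⟩
    have hub : rch (Function.update a s(x, y) true) u b = rch a u b := by
      unfold rch; rw [cfg_update_true]; exact ir_congr (reachable_insert_iff_of_not_reachable hux huy b)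
    rw [hub]

/-- The whole fold after opening `e` in replica 3 equals the fold at the seed set enlarged by `y`. [folklore] -/
theorem tagSum_open3 (o b u c : Fin n) (a₁ a₂ a : Sym2 (Fin n) → Bool) (x y : Fin n) :
    ∀ (tags : List (Fin n × Bool)) (A : Finset (Fin n)), (∃ z ∈ A, (openGraph (cfg a)).Reachable z x) →
      tagSum o b u c (a₁, a₂, Function.update a s(x, y) true) tags A = tagSum o b u c (a₁, a₂, a) tags (insert y A) := by
  intro tags
  induction tags with
  | nil => intro A hA; exact tail3_open3 o b u c a₁ a₂ a x y A hA
  | cons hd rest ih =>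
    intro A hA
    obtain ⟨z, solo⟩ := hd
    have hA' : ∃ w ∈ insert z A, (openGraph (cfg a)).Reachable w x := by
      obtain ⟨w, hw, h⟩ := hA; exact ⟨w, Finset.mem_insert_of_mem hw, h⟩
    simp only [tagSum, wNon, wSeed]
    rw [ih A hA, ih (insert z A) hA', Finset.insert_comm]

end TagFold

/-! ### The pointwise step for the tagged summand -/

section StepL

variable {n : ℕ}

/-- If `p` reaches neither endpoint of the inserted edge, all its connection indicators are unchanged. [folklore] -/
theorem rch_update_of_not_reach (a : Sym2 (Fin n) → Bool) {p x y : Fin n} (hx : ¬ (openGraph (cfg a)).Reachable p x)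
    (hy : ¬ (openGraph (cfg a)).Reachable p y) (z : Fin n) : rch (Function.update a s(x, y) true) p z = rch a p z := by
  unfold rch; rw [cfg_update_true]; exact ir_congr (reachable_insert_iff_of_not_reachable hx hy z)

/-- Same, with the fixed vertex in the second slot. [folklore] -/
theorem rch_update_of_not_reach' (a : Sym2 (Fin n) → Bool) {p x y : Fin n} (hx : ¬ (openGraph (cfg a)).Reachable p x)
    (hy : ¬ (openGraph (cfg a)).Reachable p y) (z : Fin n) : rch (Function.update a s(x, y) true) z p = rch a z p := by
  unfold rch; rw [cfg_update_true]
  exact ir_congr (by rw [SimpleGraph.reachable_comm, reachable_insert_iff_of_not_reachable hx hy z, SimpleGraph.reachable_comm])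

/-- A vertex joined to `y` (or already to `v`) is joined to `v` after inserting `s(x,y)` with `x` in `v`'s cluster. [folklore] -/
theorem rch_update_eq_one (a : Sym2 (Fin n) → Bool) {p x y v : Fin n} (hvx : (openGraph (cfg a)).Reachable v x)
    (h : (openGraph (cfg a)).Reachable p v ∨ (openGraph (cfg a)).Reachable p y) : rch (Function.update a s(x, y) true) p v = 1 := by
  unfold rch; rw [cfg_update_true]; apply ir_of_true
  rcases h with h | h
  · exact reachable_insert_of_reachable h
  · exact ((reachable_insert_of_reachable h).trans (reachable_insert_endpoints (cfg a) x y).symm).trans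
      (reachable_insert_of_reachable hvx.symm)

/-- The tagged summand started from an arbitrary seed set `A₀` (the recursion only ever uses `A₀ ⊇ {v}`). [folklore] -/
noncomputable def tagSummandA (o b u v c : Fin n) (tags : List (Fin n × Bool)) (A₀ : Finset (Fin n)) (t : Triple (Sym2 (Fin n))) : ℝ :=
  headFac u v c t * tagSum o b u c t tags A₀

/-- `tagSummandL` is the case `A₀ = {v}`. [folklore] -/
theorem tagSummandL_eq (o b u v c : Fin n) (tags : List (Fin n × Bool)) (t : Triple (Sym2 (Fin n))) :
    tagSummandL o b u v c tags t = tagSummandA o b u v c tags {v} t := rfl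

variable (o b u v c : Fin n) {x y : Fin n}

/-- Replica 1 opened at `e = s(x,y)` (`x` in `v`'s replica-1 cluster): the tagged summand picks up `[c ↮₁ y]`. [folklore] -/
theorem tagSummandA_rep1 (tags : List (Fin n × Bool)) (A₀ : Finset (Fin n)) (a₁ a₂ a₃ : Sym2 (Fin n) → Bool)
    (hvx : (openGraph (cfg a₁)).Reachable v x) :
    tagSummandA o b u v c tags A₀ (Function.update a₁ s(x, y) true, a₂, a₃) =
      (1 - rch a₁ c y) * tagSummandA o b u v c tags A₀ (a₁, a₂, a₃) := by
  unfold tagSummandA headFac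
  simp only
  by_cases hcv : (openGraph (cfg a₁)).Reachable c v
  · rw [rch_update_eq_one a₁ hvx (Or.inl hcv), show rch a₁ c v = 1 from ir_of_true hcv]; ring
  · by_cases hcy : (openGraph (cfg a₁)).Reachable c y
    · rw [rch_update_eq_one a₁ hvx (Or.inr hcy), show rch a₁ c y = 1 from ir_of_true hcy]; ring
    · have hcx : ¬ (openGraph (cfg a₁)).Reachable c x := fun h => hcv (h.trans hvx.symm)
      have hc := rch_update_of_not_reach a₁ hcx hcy
      rw [tagSum_congr_rep1 o b u c a₁ _ a₂ a₃ hc (rch_update_of_not_reach' a₁ hcx hcy o) tags A₀, hc u, hc v,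
        show rch a₁ c y = 0 from ir_of_false hcy]
      ring

/-- Replica 2 opened: the tagged summand picks up `[u ↮₂ y]`. [folklore] -/
theorem tagSummandA_rep2 (tags : List (Fin n × Bool)) (A₀ : Finset (Fin n)) (a₁ a₂ a₃ : Sym2 (Fin n) → Bool)
    (hvx : (openGraph (cfg a₂)).Reachable v x) :
    tagSummandA o b u v c tags A₀ (a₁, Function.update a₂ s(x, y) true, a₃) =
      (1 - rch a₂ u y) * tagSummandA o b u v c tags A₀ (a₁, a₂, a₃) := by
  unfold tagSummandA headFac
  simp only
  by_cases huv : (openGraph (cfg a₂)).Reachable u v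
  · rw [rch_update_eq_one a₂ hvx (Or.inl huv), show rch a₂ u v = 1 from ir_of_true huv]; ring
  · by_cases huy : (openGraph (cfg a₂)).Reachable u y
    · rw [rch_update_eq_one a₂ hvx (Or.inr huy), show rch a₂ u y = 1 from ir_of_true huy]; ring
    · have hux : ¬ (openGraph (cfg a₂)).Reachable u x := fun h => huv (h.trans hvx.symm)
      have hu := rch_update_of_not_reach a₂ hux huy
      rw [tagSum_congr_rep2 o b u c a₁ a₂ _ a₃ hu tags A₀, hu v, show rch a₂ u y = 0 from ir_of_false huy]
      ring

/-- Replica 3 opened: `y` joins the seed set. [folklore] -/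
theorem tagSummandA_rep3 (tags : List (Fin n × Bool)) (A₀ : Finset (Fin n)) (a₁ a₂ a₃ : Sym2 (Fin n) → Bool)
    (hA : ∃ z ∈ A₀, (openGraph (cfg a₃)).Reachable z x) :
    tagSummandA o b u v c tags A₀ (a₁, a₂, Function.update a₃ s(x, y) true) =
      tagSummandA o b u v c tags (insert y A₀) (a₁, a₂, a₃) := by
  unfold tagSummandA headFac
  simp only
  rw [tagSum_open3 o b u c a₁ a₂ a₃ x y tags A₀ hA]

variable {o b u v c} {t : Triple (Sym2 (Fin n))}

/-- **Pointwise solo step for the tagged summand.** [folklore] -/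
theorem tagSummandL_soloStep (tags : List (Fin n × Bool)) (h1 : t.1 s(x, y) = false) (h2 : t.2.1 s(x, y) = false)
    (h3 : t.2.2 s(x, y) = false) (hvx₁ : (openGraph (cfg t.1)).Reachable v x) (hvx₂ : (openGraph (cfg t.2.1)).Reachable v x)
    (hvx₃ : (openGraph (cfg t.2.2)).Reachable v x) :
    tagSummandL o b u v c tags (setAt s(x, y) true false false t) + tagSummandL o b u v c tags (setAt s(x, y) false true false t) +
        tagSummandL o b u v c tags (setAt s(x, y) false false true t) =
      tagSummandL o b u v c tags (setAt s(x, y) true true true t) + tagSummandL o b u v c ((y, true) :: tags) t := by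
  have hA : ∃ z ∈ ({v} : Finset (Fin n)), (openGraph (cfg t.2.2)).Reachable z x := ⟨v, Finset.mem_singleton_self v, hvx₃⟩
  simp only [tagSummandL_eq, setAt, update_false_of_eq h1, update_false_of_eq h2, update_false_of_eq h3]
  rw [tagSummandA_rep1 o b u v c tags {v} t.1 t.2.1 t.2.2 hvx₁, tagSummandA_rep2 o b u v c tags {v} t.1 t.2.1 t.2.2 hvx₂,
    tagSummandA_rep3 o b u v c tags {v} t.1 t.2.1 t.2.2 hA,
    tagSummandA_rep1 o b u v c tags {v} t.1 _ _ hvx₁, tagSummandA_rep2 o b u v c tags {v} t.1 t.2.1 _ hvx₂,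
    tagSummandA_rep3 o b u v c tags {v} t.1 t.2.1 t.2.2 hA]
  unfold tagSummandA
  simp only [tagSum, wNon, wSeed, if_true]
  ring

/-- **Pointwise duo step for the tagged summand.** [folklore] -/
theorem tagSummandL_duoStep (tags : List (Fin n × Bool)) (h1 : t.1 s(x, y) = false) (h2 : t.2.1 s(x, y) = false)
    (h3 : t.2.2 s(x, y) = false) (hvx₁ : (openGraph (cfg t.1)).Reachable v x) (hvx₂ : (openGraph (cfg t.2.1)).Reachable v x)
    (hvx₃ : (openGraph (cfg t.2.2)).Reachable v x) :
    tagSummandL o b u v c tags (setAt s(x, y) true true false t) + tagSummandL o b u v c tags (setAt s(x, y) true false true t) +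
        tagSummandL o b u v c tags (setAt s(x, y) false true true t) =
      tagSummandL o b u v c tags (setAt s(x, y) true true true t) + tagSummandL o b u v c ((y, false) :: tags) t := by
  have hA : ∃ z ∈ ({v} : Finset (Fin n)), (openGraph (cfg t.2.2)).Reachable z x := ⟨v, Finset.mem_singleton_self v, hvx₃⟩
  simp only [tagSummandL_eq, setAt, update_false_of_eq h1, update_false_of_eq h2, update_false_of_eq h3]
  rw [tagSummandA_rep1 o b u v c tags {v} t.1 _ t.2.2 hvx₁, tagSummandA_rep2 o b u v c tags {v} t.1 t.2.1 t.2.2 hvx₂,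
    tagSummandA_rep1 o b u v c tags {v} t.1 t.2.1 _ hvx₁, tagSummandA_rep3 o b u v c tags {v} t.1 t.2.1 t.2.2 hA,
    tagSummandA_rep2 o b u v c tags {v} t.1 t.2.1 _ hvx₂,
    tagSummandA_rep1 o b u v c tags {v} t.1 _ _ hvx₁, tagSummandA_rep2 o b u v c tags {v} t.1 t.2.1 _ hvx₂,
    tagSummandA_rep3 o b u v c tags {v} t.1 t.2.1 t.2.2 hA]
  unfold tagSummandA
  simp only [tagSum, wNon, wSeed, Bool.false_eq_true, if_false]
  ring

end StepL

/-! ### The recursion at the level of fibre sums, and the reduction of (CNT) to the core-inert base case -/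

section Recursion

variable {n : ℕ}

/-- **Solo step of the tagged recursion (exact).**  For every edge `e = s(x, y)` with `x` in the `3`-component of `v` and `I e = 1`
(no condition on `y`). [folklore] -/
theorem fibreSumL_soloStep (o b u v c : Fin n) (tags : List (Fin n × Bool)) (I : Sym2 (Fin n) → ℕ) (x y : Fin n)
    (he : I s(x, y) = 1) (hx : (openGraph {f | I f = 3}).Reachable v x) :
    fibreSumF (tagSummandL o b u v c tags) I = fibreSumF (tagSummandL o b u v c tags) (Function.update I s(x, y) 3) +
      fibreSumF (tagSummandL o b u v c ((y, true) :: tags)) (Function.update I s(x, y) 0) := by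
  rw [fibreSumF_split_one _ I s(x, y) he,
    fibreSumF_split_three _ (Function.update I s(x, y) 3) s(x, y) (Function.update_self _ _ _), Function.update_idem,
    ← fibreSumF_add, ← fibreSumF_add, ← fibreSumF_add]
  refine fibreSumF_congr fun t ht => ?_
  obtain ⟨h1, h2, h3⟩ := apply_eq_false_of_cnt_eq_zero (t := t) (e := s(x, y)) (by rw [ht, Function.update_self])
  obtain ⟨hv1, hv2, hv3⟩ := reach_replicas_of_three (by rw [he]; decide) hx ht
  exact tagSummandL_soloStep tags h1 h2 h3 hv1 hv2 hv3

/-- **Duo step of the tagged recursion (exact).** [folklore] -/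
theorem fibreSumL_duoStep (o b u v c : Fin n) (tags : List (Fin n × Bool)) (I : Sym2 (Fin n) → ℕ) (x y : Fin n)
    (he : I s(x, y) = 2) (hx : (openGraph {f | I f = 3}).Reachable v x) :
    fibreSumF (tagSummandL o b u v c tags) I = fibreSumF (tagSummandL o b u v c tags) (Function.update I s(x, y) 3) +
      fibreSumF (tagSummandL o b u v c ((y, false) :: tags)) (Function.update I s(x, y) 0) := by
  rw [fibreSumF_split_two _ I s(x, y) he,
    fibreSumF_split_three _ (Function.update I s(x, y) 3) s(x, y) (Function.update_self _ _ _), Function.update_idem,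
    ← fibreSumF_add, ← fibreSumF_add, ← fibreSumF_add]
  refine fibreSumF_congr fun t ht => ?_
  obtain ⟨h1, h2, h3⟩ := apply_eq_false_of_cnt_eq_zero (t := t) (e := s(x, y)) (by rw [ht, Function.update_self])
  obtain ⟨hv1, hv2, hv3⟩ := reach_replicas_of_three (by rw [he]; decide) hx ht
  exact tagSummandL_duoStep tags h1 h2 h3 hv1 hv2 hv3

/-- Deleting a random edge also lowers the number of random edges. [folklore] -/
theorem card_random_lt_of_update_zero {I : Sym2 (Fin n) → ℕ} {e : Sym2 (Fin n)} (he : I e = 1 ∨ I e = 2) :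
    ((Finset.univ : Finset (Sym2 (Fin n))).filter (fun f => Function.update I e 0 f = 1 ∨ Function.update I e 0 f = 2)).card <
      ((Finset.univ : Finset (Sym2 (Fin n))).filter (fun f => I f = 1 ∨ I f = 2)).card := by
  apply Finset.card_lt_card
  rw [Finset.ssubset_iff_of_subset]
  · refine ⟨e, Finset.mem_filter.2 ⟨Finset.mem_univ _, he⟩, ?_⟩
    simp only [Finset.mem_filter, Finset.mem_univ, true_and, Function.update_self]
    omega
  · intro f hf
    simp only [Finset.mem_filter, Finset.mem_univ, true_and] at hf ⊢
    by_cases hfe : f = e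
    · rw [hfe, Function.update_self] at hf; omega
    · rwa [Function.update_of_ne hfe] at hf

/-- The `3`-set is unchanged when a non-`3` coordinate is set to `0`. [folklore] -/
theorem threeSet_update_zero {I : Sym2 (Fin n) → ℕ} {e : Sym2 (Fin n)} (he : I e ≠ 3) :
    {f | Function.update I e 0 f = 3} = {f | I f = 3} := by
  ext f
  simp only [Set.mem_setOf_eq]
  by_cases hfe : f = e
  · rw [hfe, Function.update_self]; constructor <;> intro h <;> omega
  · rw [Function.update_of_ne hfe]

/-- A count vector with a value above `3` has an empty fibre. [folklore] -/
theorem fibreSumF_eq_zero_of_three_lt (F : Triple (Sym2 (Fin n)) → ℝ) (I : Sym2 (Fin n) → ℕ) {e : Sym2 (Fin n)}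
    (he : 3 < I e) : fibreSumF F I = 0 := by
  unfold fibreSumF
  refine Finset.sum_eq_zero fun t ht => ?_
  exfalso
  have hI := (Finset.mem_filter.1 ht).2
  have : cnt t e ≤ 3 := by
    unfold cnt cnt3
    cases t.1 e <;> cases t.2.1 e <;> cases t.2.2 e <;> simp
  rw [hI] at this
  omega

/-- **(CNT) and all tagged counts from the core-inert base case.**  Suppose every tagged count whose count vector has no random edge
(`I ∈ {1,2}`) at the `3`-component of `v` is nonnegative.  Then EVERY tagged count is nonnegative — by induction on the number of
random edges, contracting/deleting one random core edge at a time with `fibreSumL_soloStep` / `fibreSumL_duoStep`. [folklore] -/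
theorem fibreSumL_nonneg_of_base (o b u v c : Fin n)
    (hbase : ∀ (tags : List (Fin n × Bool)) (I : Sym2 (Fin n) → ℕ),
      (∀ x z : Fin n, (openGraph {f | I f = 3}).Reachable v x → ¬ (I s(x, z) = 1 ∨ I s(x, z) = 2)) →
      0 ≤ fibreSumF (tagSummandL o b u v c tags) I)
    (tags : List (Fin n × Bool)) (I : Sym2 (Fin n) → ℕ) : 0 ≤ fibreSumF (tagSummandL o b u v c tags) I := by
  generalize hm : ((Finset.univ : Finset (Sym2 (Fin n))).filter (fun f => I f = 1 ∨ I f = 2)).card = m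
  induction m using Nat.strong_induction_on generalizing I tags with
  | _ m ih =>
    by_cases hex : ∃ x z : Fin n, (openGraph {f | I f = 3}).Reachable v x ∧ (I s(x, z) = 1 ∨ I s(x, z) = 2)
    · obtain ⟨x, z, hx, he⟩ := hex
      have hne3 : I s(x, z) ≠ 3 := by omega
      have h3 : 0 ≤ fibreSumF (tagSummandL o b u v c tags) (Function.update I s(x, z) 3) :=
        ih _ (hm ▸ card_random_lt_of_update he) _ _ rfl
      rcases he with he | he
      · have h0 : 0 ≤ fibreSumF (tagSummandL o b u v c ((z, true) :: tags)) (Function.update I s(x, z) 0) :=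
          ih _ (hm ▸ card_random_lt_of_update_zero (Or.inl he)) _ _ rfl
        rw [fibreSumL_soloStep o b u v c tags I x z he hx]
        exact add_nonneg h3 h0
      · have h0 : 0 ≤ fibreSumF (tagSummandL o b u v c ((z, false) :: tags)) (Function.update I s(x, z) 0) :=
          ih _ (hm ▸ card_random_lt_of_update_zero (Or.inr he)) _ _ rfl
        rw [fibreSumL_duoStep o b u v c tags I x z he hx]
        exact add_nonneg h3 h0
    · exact hbase tags I fun x z hx he => hex ⟨x, z, hx, he⟩

/-- **(CNT) from (KEY₃).**  Under the base hypothesis every fibre count of (T) at the roles `o b u v c` is nonnegative. [folklore] -/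
theorem fibreSumT_nonneg_of_base (o b u v c : Fin n)
    (hbase : ∀ (tags : List (Fin n × Bool)) (I : Sym2 (Fin n) → ℕ),
      (∀ x z : Fin n, (openGraph {f | I f = 3}).Reachable v x → ¬ (I s(x, z) = 1 ∨ I s(x, z) = 2)) →
      0 ≤ fibreSumF (tagSummandL o b u v c tags) I)
    (I : Sym2 (Fin n) → ℕ) : 0 ≤ fibreSumT o b u v c I := by
  rw [fibreSumT_eq_fibreSumF, show summandT o b u v c = tagSummandL o b u v c [] from
    funext fun t => (tagSummandL_nil o b u v c t).symm]
  exact fibreSumL_nonneg_of_base o b u v c hbase [] I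

/-- **The kernel (T) from (KEY₃).**  Under the base hypothesis the registered covariance-transfer inequality (T) holds at
`(n, w, o, b, u, v, c)` for every weight vector `w`. [folklore] -/
theorem covTransferQ_of_base (w : Sym2 (Fin n) → unitInterval) (o b u v c : Fin n)
    (hbase : ∀ (tags : List (Fin n × Bool)) (I : Sym2 (Fin n) → ℕ),
      (∀ x z : Fin n, (openGraph {f | I f = 3}).Reachable v x → ¬ (I s(x, z) = 1 ∨ I s(x, z) = 2)) →
      0 ≤ fibreSumF (tagSummandL o b u v c tags) I) :
    (prodBernoulli w).real ((openConn u v)ᶜ : Set (BondConfig (Fin n))) *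
        ((prodBernoulli w).real ((openConn u v)ᶜ ∩ openConn u b ∩ openConn v o : Set (BondConfig (Fin n))) *
            (prodBernoulli w).real ((openConn c u)ᶜ ∩ (openConn c v)ᶜ : Set (BondConfig (Fin n))) -
          (prodBernoulli w).real ((openConn u v)ᶜ ∩ openConn u b ∩ openConn v c : Set (BondConfig (Fin n))) *
            (prodBernoulli w).real ((openConn c u)ᶜ ∩ (openConn c v)ᶜ ∩ openConn o c : Set (BondConfig (Fin n)))) ≤
      (prodBernoulli w).real ((openConn u v)ᶜ ∩ openConn u b : Set (BondConfig (Fin n))) *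
        ((prodBernoulli w).real ((openConn u v)ᶜ ∩ openConn v o : Set (BondConfig (Fin n))) *
            (prodBernoulli w).real ((openConn c u)ᶜ ∩ (openConn c v)ᶜ : Set (BondConfig (Fin n))) -
          (prodBernoulli w).real ((openConn u v)ᶜ ∩ openConn v c : Set (BondConfig (Fin n))) *
            (prodBernoulli w).real ((openConn c u)ᶜ ∩ (openConn c v)ᶜ ∩ openConn o c : Set (BondConfig (Fin n)))) :=
  covTransferQ_of_fibres w o b u v c (fibreSumT_nonneg_of_base o b u v c hbase)

end Recursion

end Summit.CriticalPhenomena.PercolationContinuityZ3.Cruxes.AdditiveGluing.TieLine.FibreCount
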